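import Literature.AnabelianGeometry.EtaleTheta.TemperedFrobenioidCor38Sub
import Literature.AlgebraicGeometry.Frobenioids.BiratGerms

/-!
# [EtTh] Corollary 3.8 (i)(ii) sub-DAG — rows C38-L07b and C38-L09 (derivation) PROVED

Mochizuki, *The étale theta function …*, Publ. RIMS **45** (2009), Cor. 3.8, proof PDF pp. 81–82
[cite: MochizukiEtTh2009, Cor 3.8 p.81]. abc-iut cell, layer L2, seat abc-iut-w5-d124; proof-only companion
(0 definitions) of the statements-first sub-DAG file `TemperedFrobenioidCor38Sub.lean` (p413893/p414329,
plan/L2/SUBDAG-EtTh-Cor38.md), discharging two of its rows: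
* **C38-L07b** `TemperedFrobenioid.bsFldOfFactorisation_of_isFrobenioid`: for `f = F ≫ φ ≫ λ` (Frobenius type ≫
  pre-step ≫ pull-back) in the Frobenioid of a tempered Frobenioid, `f` is base-field-theoretic iff `φ` is —
  `Div(f) = Base(F)^* Div(φ)` by the model-Frobenioid composition law, `Div(F) = Div(λ) = 0` and `deg_Fr(λ) = 1`
  ([FrdI] Def. 1.3 (iv)(b) `IsFrobenioid.iv_b`), and `Φ^{bs-fld}` is a subfunctor;
* **C38-L09 derivation** `Cor38Hyp.preservesFrobeniusTrivial_of_inputs : h.PreservesFrobeniusTrivialOfInputs`: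
  the base squares of [FrdI] Cor. 4.11 (ii) and [FrdI] Thm. 3.4 (iii) make `Ψ`, `Ψ⁻¹` carry Frobenius-trivial
  objects to Frobenius-trivial objects (transport of the section `ζ : ℕ_{≥1} → End(A)`).
HONEST FRAMING: refereed pre-IUT material; nothing here bears on [IUTchIII] Cor. 3.12; typed ≠ proved elsewhere.
-/

namespace Literature.AnabelianGeometry.EtaleTheta

open CategoryTheory Opposite Literature.AlgebraicGeometry.Frobenioids

universe u₀ v₀ u v w

variable {D₀ : Type u₀} [Category.{v₀} D₀] {V : FrdIMonoidStub.{w}}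
  {T : RealifiedDivisorMonoids (D₀ := D₀) V} {D : Type u} [Category.{v} D] {VD : FrdICatStub.{u, v, w} D}

namespace TemperedFrobenioid

variable (C : TemperedFrobenioid T D VD)

/-- **C38-L07b PROVED**: for `f = F ≫ φ ≫ λ` with `F` of Frobenius type, `φ` a pre-step and `λ` a pull-back
morphism of the Frobenioid of a tempered Frobenioid (a Frobenioid, `hF`), `f` is base-field-theoretic iff `φ`
is: `Div(f) = Base(F)^* Div(φ)` since `Div(F) = Div(λ) = 0`, `deg_Fr(λ) = 1` ([FrdI] Def. 1.3 (iv)(b)), and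
`Φ^{bs-fld}` is a subfunctor stable under pull-back along the isomorphism `Base(F)`.
[cite: MochizukiEtTh2009, Cor 3.8 p.81] -/
theorem bsFldOfFactorisation_of_isFrobenioid (hF : PreFrobenioid.IsFrobenioid C.toElem) :
    C.BsFldOfFactorisation := by
  intro A A' B' B F φ l hFt _hφ hl
  have hFt' := (PreFrobenioidData.ofFunctor_isFrobeniusType C.toElem F).1 hFt
  have hl' := (PreFrobenioidData.ofFunctor_isPullbackMorphism C.toElem l).1 hl
  obtain ⟨hlLB, hllin⟩ := hF.iv_b l hl'
  have hdivl : ModelFrobenioid.div l = 1 := hlLB.2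
  have hdegl : ModelFrobenioid.degFr l = 1 := hllin
  have hdivF : ModelFrobenioid.div F = 1 := hFt'.1.2
  haveI : IsIso (ModelFrobenioid.baseMap F) := hFt'.2
  change C.IsBaseFieldTheoreticDiv (ModelFrobenioid.div (F ≫ φ ≫ l)) ↔
    C.IsBaseFieldTheoreticDiv (ModelFrobenioid.div φ)
  have hdiv : ModelFrobenioid.div (F ≫ φ ≫ l) =
      pull C.divisorMonoid (ModelFrobenioid.baseMap F) (ModelFrobenioid.div φ) := by
    simp only [ModelFrobenioid.div_comp, hdivl, hdivF, hdegl, map_one, one_mul, one_pow, mul_one,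
      PNat.one_coe, pow_one]
    rfl
  rw [hdiv]
  -- `Φ^{bs-fld}` is a subfunctor of `Φ^{ℝ-log}`: stable under pull-back (both along `Base(F)` and its inverse)
  refine ⟨fun h => ?_, fun h => C.bsFld.map_mem (ModelFrobenioid.baseMap F).op _ h⟩
  have h' : C.IsBaseFieldTheoreticDiv
      (pull C.divisorMonoid (inv (ModelFrobenioid.baseMap F))
        (pull C.divisorMonoid (ModelFrobenioid.baseMap F) (ModelFrobenioid.div φ))) :=
    C.bsFld.map_mem (inv (ModelFrobenioid.baseMap F)).op _ h
  rwa [PreFrobenioid.pull_inv_pull_eq] at h'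

end TemperedFrobenioid


namespace Cor38Hyp

variable {D₀' : Type u₀} [Category.{v₀} D₀'] {T' : RealifiedDivisorMonoids (D₀ := D₀') V}
  {D' : Type u} [Category.{v} D'] {VD' : FrdICatStub.{u, v, w} D'}
  {C₁ : TemperedFrobenioid T D VD} {C₂ : TemperedFrobenioid T' D' VD'} (h : Cor38Hyp C₁ C₂)

/-- `C` not of group-like type ⟹ some object is not group-like (bookkeeping). [cite: MochizukiFrdI2008, Def. 1.2 (v) p.23] -/
theorem exists_not_isGroupLikeObj_of {E : Type*} [Category E] {B : Type*} [Category B]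
    (S : PreFrobenioidData E B) (hS : ¬ S.IsOfGroupLikeType) : ∃ A, ¬ S.IsGroupLikeObj A := by
  by_contra hcon
  exact hS ⟨fun A => Classical.byContradiction fun hA => hcon ⟨A, hA⟩⟩

/-- **C38-L09 derivation PROVED**: `Ψ` (and `Ψ⁻¹`) carry Frobenius-trivial objects to Frobenius-trivial objects,
from the base squares of [FrdI] Cor. 4.11 (ii) and [FrdI] Thm. 3.4 (iii): transport the section
`ζ : ℕ_{≥1} → End(A)` along `Ψ`; degrees are preserved because `C₁`, `C₂` admit non-group-like objects,
base-identity by the base square, Frobenius type by Thm. 3.4 (iii). [cite: MochizukiEtTh2009, Cor 3.8 p.82] -/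
theorem preservesFrobeniusTrivial_of_inputs : h.PreservesFrobeniusTrivialOfInputs := by
  intro hsq hsq' h12 h21 H hB hB'
  obtain ⟨ΨB, -, hc, -⟩ := hsq
  obtain ⟨ΨB', -, hc', -⟩ := hsq'
  have hng₁ := exists_not_isGroupLikeObj_of C₁.opsData H.notGroupLike.1
  have hng₂ := exists_not_isGroupLikeObj_of C₂.opsData H.notGroupLike.2
  obtain ⟨hmor, ΨN, hdeg, hN⟩ := h12 H.standard.1 H.standard.2 hB
  have hN1 : ΨN = MulEquiv.refl ℕ+ := hN hng₁ hng₂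
  obtain ⟨hmor', ΨN', hdeg', hN'⟩ := h21 H.standard.2 H.standard.1 hB'
  have hN1' : ΨN' = MulEquiv.refl ℕ+ := hN' hng₂ hng₁
  refine ⟨fun A hA => ?_, fun A hA => ?_⟩
  · obtain ⟨ζ, hζ⟩ := hA
    refine ⟨(Functor.mapEnd A h.Ψ.functor).comp ζ, fun n => ⟨?_, ?_, ?_⟩⟩
    · rw [MonoidHom.comp_apply, Functor.mapEnd_apply, hdeg, hN1, (hζ n).1]; rfl
    · rw [MonoidHom.comp_apply, Functor.mapEnd_apply]
      exact isBaseIdentity_map_of_oneCommutes C₁.opsData C₂.opsData h.Ψ.functor ΨB hc (hζ n).2.1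
    · rw [MonoidHom.comp_apply, Functor.mapEnd_apply]
      exact hmor.1 _ (hζ n).2.2
  · obtain ⟨ζ, hζ⟩ := hA
    refine ⟨(Functor.mapEnd A h.Ψ.inverse).comp ζ, fun n => ⟨?_, ?_, ?_⟩⟩
    · rw [MonoidHom.comp_apply, Functor.mapEnd_apply]
      change C₁.opsData.degFr (h.Ψ.symm.functor.map (ζ n)) = n
      rw [hdeg', hN1', (hζ n).1]; rfl
    · rw [MonoidHom.comp_apply, Functor.mapEnd_apply]
      exact isBaseIdentity_map_of_oneCommutes C₂.opsData C₁.opsData h.Ψ.inverse ΨB' hc' (hζ n).2.1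
    · rw [MonoidHom.comp_apply, Functor.mapEnd_apply]
      exact hmor'.1 _ (hζ n).2.2

end Cor38Hyp

end Literature.AnabelianGeometry.EtaleTheta
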